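import Summits.PneNP.PneNP.Theorems.SymmetryBudgetHamCompilesStubKotzigAux2
import Summits.PneNP.PneNP.Theorems.SymmetryBudgetHamCompilesStubKotzigAux3

/-!
# Stub `stub_kotzig` of line `kotzig-cutspan` (crux `SymmetryBudget.HamCompiles`,
stmt-PneNP-10637) — auxiliary file 5

Route `PneNP/SymmetryBudget`, crux `Summit.PneNP.PneNP.Theses.SymmetryBudget.HamCompiles`, line
`kotzig-cutspan`, stub `stub_kotzig` (`G.IsHamiltonian ↔ KotzigPred G F`).

* Reading the closed alternating trail off a full transition system (`exists_full_transition`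
  of auxiliary file 2): the orbit of the A-dart `inl h₀` under the trail permutation `θ`
  alternates A-darts `inl (s^[t] h₀)` and F-darts, where `s` ("one A-edge and one F-edge
  further", carried as a variable with its defining equation `hs`) is
  `h ↦ φ (other end of φ⁻¹ (other end of h))`; `alternating_trail` packages the trail as two
  step functions `sA : ℕ → ιA × Bool`, `sF : ℕ → ιF × Bool` (the A-edge entered at step `t`,
  with its entry end, and the F-edge entered next) with period `n`, hitting every A-edge and
  every F-edge exactly once per period, consecutive junctions carrying equal labels.
* The end of the backward direction: `isHamCycleListing_assemble` turns the closed alternating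
  trail of `alternating_trail` into a cyclic vertex listing (`IsHamCycleListing`) by
  concatenating the oriented vertex lists of the paths it traverses — consecutive paths are
  joined by edges of `G` because at every junction an A-end lying in a class key meets an F-end
  with that key, and `a ∈ nbA G F u'` means `G.Adj u' a`; `isHamiltonian_of_kotzigPred`
  concludes with `isHamiltonian_iff_of_three_le_card`.
-/

-- `Summit.PneNP.PneNP.…` duplicates `PneNP` BY DESIGN (single-problem summit, D-0017).
set_option linter.dupNamespace false

namespace Summit.PneNP.PneNP.Theorems.HamCompilesKC

open Finset Literature.Combinatorics.SimpleGraph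

/-! ### Reading the trail off a full transition system -/

namespace KotzigTrail

open Equiv Equiv.Perm

section Read

variable {ιA ιF L : Type*} {φ : (ιF × Bool) ≃ (ιA × Bool)}
  {θ : Perm ((ιA × Bool) ⊕ (ιF × Bool))}
  (hl : ∀ h, θ (Sum.inl h) = Sum.inr (φ.symm (Prod.map id not h)))
  (hr : ∀ f, θ (Sum.inr f) = Sum.inl (φ (Prod.map id not f)))
  {s : ιA × Bool → ιA × Bool} (hs : ∀ h, s h = φ (Prod.map id not (φ.symm (Prod.map id not h))))

include hl hr hs in
/-- Even powers of `θ` on an A-dart are the iterates of `s`. -/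
theorem theta_pow_two_mul (h : ιA × Bool) (t : ℕ) :
    (θ ^ (2 * t)) (Sum.inl h) = Sum.inl (s^[t] h) := by
  induction t with
  | zero => simp
  | succ t ih =>
    rw [show 2 * (t + 1) = (2 * t + 1) + 1 by ring, pow_succ', pow_succ', Perm.mul_apply,
      Perm.mul_apply, ih, hl, hr, Function.iterate_succ_apply', hs]

include hl hr hs in
/-- Odd powers of `θ` on an A-dart are F-darts. -/
theorem theta_pow_two_mul_add_one (h : ιA × Bool) (t : ℕ) :
    (θ ^ (2 * t + 1)) (Sum.inl h) = Sum.inr (φ.symm (Prod.map id not (s^[t] h))) := by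
  rw [pow_succ', Perm.mul_apply, theta_pow_two_mul hl hr hs, hl]

include hs in
/-- `s` is injective. -/
theorem step_injective : Function.Injective s := fun a b h => by
  rw [hs, hs] at h
  exact flipEnd_injective (φ.symm.injective (flipEnd_injective (φ.injective h)))

variable [Fintype ιA] [Fintype ιF]

include hl hr in
/-- A point of the orbit of `z₀` under `θ` is not the reverse of another point of that orbit. -/
theorem pow_apply_ne_flip_pow_apply (z₀ : (ιA × Bool) ⊕ (ιF × Bool)) (i j : ℕ) :
    (θ ^ i) z₀ ≠ Sum.map (Prod.map id not) (Prod.map id not) ((θ ^ j) z₀) := by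
  intro h
  apply not_sameCycle_flip hl hr ((θ ^ j) z₀)
  rw [← h]
  exact (sameCycle_pow_left.2 (SameCycle.refl _ z₀)).trans
    (sameCycle_pow_right.2 (SameCycle.refl _ z₀))

include hl hr hs in
/-- Within a period, the A-edges entered by the trail are distinct (an edge entered twice would be
entered once from each end, i.e. the orbit would contain a dart and its reverse). -/
theorem iterate_fst_injOn (h₀ : ιA × Bool) {a b : ℕ} (ha : a < Function.minimalPeriod s h₀)
    (hb : b < Function.minimalPeriod s h₀) (he : (s^[a] h₀).1 = (s^[b] h₀).1) : a = b := by
  rcases eq_or_eq_flipEnd_of_fst_eq he with e | e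
  · exact Function.iterate_injOn_Iio_minimalPeriod (Set.mem_Iio.2 ha) (Set.mem_Iio.2 hb) e
  · exfalso
    apply pow_apply_ne_flip_pow_apply hl hr (Sum.inl h₀) (2 * a) (2 * b)
    rw [theta_pow_two_mul hl hr hs, theta_pow_two_mul hl hr hs, e, Sum.map_inl]

include hl hr hs in
/-- Within a period, the F-edges entered by the trail are distinct. -/
theorem iterate_F_fst_injOn (h₀ : ιA × Bool) {a b : ℕ} (ha : a < Function.minimalPeriod s h₀)
    (hb : b < Function.minimalPeriod s h₀)
    (he : (φ.symm (Prod.map id not (s^[a] h₀))).1 = (φ.symm (Prod.map id not (s^[b] h₀))).1) :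
    a = b := by
  rcases eq_or_eq_flipEnd_of_fst_eq he with e | e
  · apply iterate_fst_injOn hl hr hs h₀ ha hb
    rw [flipEnd_injective (φ.symm.injective e)]
  · exfalso
    apply pow_apply_ne_flip_pow_apply hl hr (Sum.inl h₀) (2 * a + 1) (2 * b + 1)
    rw [theta_pow_two_mul_add_one hl hr hs, theta_pow_two_mul_add_one hl hr hs, e, Sum.map_inr]

variable [DecidableEq ιA] [DecidableEq ιF] [DecidableEq L]

omit hl hr in
/-- **The closed alternating trail.** Balanced connected labels admit step functions `sA`, `sF`
of some period `n > 0` from `h₀`: step `t` enters the A-edge `(sA t).1` at its end `(sA t).2`,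
leaves at the other end, enters the F-edge `(sF t).1` at its end `(sF t).2` and leaves at the
other end towards `sA (t+1)`; every A-edge and every F-edge is entered exactly once per period, and
the two half-edges of every junction carry the same label. -/
theorem alternating_trail (la : ιA × Bool → L) (lf : ιF × Bool → L) (h₀ : ιA × Bool)
    (hbal : ∀ i, (univ.filter fun f => lf f = i).card = (univ.filter fun h => la h = i).card)
    (hconn : ∀ P : L → Prop, P (la h₀) → (∀ h, P (la h) → P (la (Prod.map id not h))) →
      (∀ f, P (lf f) → P (lf (Prod.map id not f))) → ∀ h, P (la h)) :
    ∃ (n : ℕ) (sA : ℕ → ιA × Bool) (sF : ℕ → ιF × Bool), 0 < n ∧ sA 0 = h₀ ∧ sA n = h₀ ∧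
      (∀ k : ιA, ∃ t < n, (sA t).1 = k) ∧ (∀ k : ιF, ∃ t < n, (sF t).1 = k) ∧
      (∀ a b, a < n → b < n → (sA a).1 = (sA b).1 → a = b) ∧
      (∀ a b, a < n → b < n → (sF a).1 = (sF b).1 → a = b) ∧
      (∀ t, la (Prod.map id not (sA t)) = lf (sF t)) ∧
      (∀ t, lf (Prod.map id not (sF t)) = la (sA (t + 1))) := by
  obtain ⟨φ, θ, hφ, hl, hr, hfull⟩ := exists_full_transition la lf h₀ hbal hconn
  obtain ⟨ε, hε⟩ := exists_eps ιA ιF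
  set s : ιA × Bool → ιA × Bool := fun h => φ (Prod.map id not (φ.symm (Prod.map id not h)))
    with hs'
  have hs : ∀ h, s h = φ (Prod.map id not (φ.symm (Prod.map id not h))) := fun h => rfl
  set n := Function.minimalPeriod s h₀ with hn
  have hnpos : 0 < n :=
    Function.minimalPeriod_pos_of_mem_periodicPts ((step_injective hs).mem_periodicPts h₀)
  have hmod : ∀ t, s^[t % n] h₀ = s^[t] h₀ := fun t => Function.iterate_mod_minimalPeriod_eq
  set z₀ : (ιA × Bool) ⊕ (ιF × Bool) := Sum.inl h₀ with hz₀
  -- visited darts, and every A-dart is visited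
  have hV : ∀ w, w ∈ {w | θ.SameCycle z₀ w ∨ θ.SameCycle z₀ (ε w)} ↔
      θ.SameCycle z₀ w ∨ θ.SameCycle z₀ (ε w) := fun w => Iff.rfl
  have hvisA : ∀ h : ιA × Bool, (Sum.inl h : (ιA × Bool) ⊕ (ιF × Bool)) ∈
      {w | θ.SameCycle z₀ w ∨ θ.SameCycle z₀ (ε w)} := fun h => by
    rw [hV, hε, Sum.map_inl]
    exact hfull h
  have hvisF : ∀ f : ιF × Bool, θ.SameCycle z₀ (Sum.inr f) ∨
      θ.SameCycle z₀ (Sum.inr (Prod.map id not f)) := fun f => by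
    have := vis_theta hε hl hr hV (hvisA (Prod.map id not (φ f)))
    rw [hV, hl, flipEnd_flipEnd, Equiv.symm_apply_apply, hε, Sum.map_inr] at this
    exact this
  have hpow : ∀ w, θ.SameCycle z₀ w → ∃ m : ℕ, (θ ^ m) z₀ = w := fun w hw => hw.exists_nat_pow_eq
  refine ⟨n, fun t => s^[t] h₀, fun t => φ.symm (Prod.map id not (s^[t] h₀)), hnpos, rfl,
    Function.iterate_minimalPeriod, ?_, ?_,
    fun a b ha hb he => iterate_fst_injOn hl hr hs h₀ ha hb he,
    fun a b ha hb he => iterate_F_fst_injOn hl hr hs h₀ ha hb he, fun t => ?_, fun t => ?_⟩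
  · intro k
    have key : ∀ b : Bool, θ.SameCycle z₀ (Sum.inl (k, b)) → ∃ t < n, (s^[t] h₀).1 = k := by
      intro b hb
      obtain ⟨m, hm⟩ := hpow _ hb
      obtain ⟨t, rfl | rfl⟩ := Nat.even_or_odd' m
      · refine ⟨t % n, Nat.mod_lt _ hnpos, ?_⟩
        rw [hmod]
        rw [theta_pow_two_mul hl hr hs] at hm
        rw [Sum.inl_injective hm]
      · rw [theta_pow_two_mul_add_one hl hr hs] at hm
        simp at hm
    rcases hfull (k, false) with h | h
    · exact key false h
    · exact key true h
  · intro k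
    have key : ∀ b : Bool, θ.SameCycle z₀ (Sum.inr (k, b)) →
        ∃ t < n, (φ.symm (Prod.map id not (s^[t] h₀))).1 = k := by
      intro b hb
      obtain ⟨m, hm⟩ := hpow _ hb
      obtain ⟨t, rfl | rfl⟩ := Nat.even_or_odd' m
      · rw [theta_pow_two_mul hl hr hs] at hm
        simp at hm
      · refine ⟨t % n, Nat.mod_lt _ hnpos, ?_⟩
        rw [hmod]
        rw [theta_pow_two_mul_add_one hl hr hs] at hm
        rw [Sum.inr_injective hm]
    rcases hvisF (k, false) with h | h
    · exact key false h
    · exact key true h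
  · show la (Prod.map id not (s^[t] h₀)) = lf (φ.symm (Prod.map id not (s^[t] h₀)))
    rw [← hφ, Equiv.apply_symm_apply]
  · show lf (Prod.map id not (φ.symm (Prod.map id not (s^[t] h₀)))) = la (s^[t + 1] h₀)
    rw [Function.iterate_succ_apply', hs, hφ]

end Read

end KotzigTrail

/-! ### Assembling the Hamiltonian cycle -/

section Backward

open KotzigTrail

variable {V : Type*} [Fintype V] [DecidableEq V] {G : SimpleGraph V} [DecidableRel G.Adj]
  {F : Finset V}

/-- **Assembling the Hamiltonian cycle.** The vertex listing read off a closed alternating trail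
through all paths of the two covers (oriented vertex lists of the A-path and the F-path of every
step, concatenated) is a cyclic Hamiltonian listing of `G`. -/
theorem isHamCycleListing_assemble {PF : List (VSeq V)}
    {PA : List (VSeq V × (Finset V × Finset V))}
    (hcF : IsCoverOf G F PF) (hcA : IsCoverOf G Fᶜ (PA.map Prod.fst))
    (hlab : ∀ q ∈ PA, q.1.first ∈ q.2.1 ∧ q.1.last ∈ q.2.2)
    {la : Fin PA.length × Bool → Finset V} {lf : Fin PF.length × Bool → Finset V}
    (hla : ∀ h, la h = bif h.2 then (PA[h.1]).2.2 else (PA[h.1]).2.1)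
    (hlf : ∀ f, lf f = nbA G F (bif f.2 then (PF[f.1]).last else (PF[f.1]).first))
    {n : ℕ} {sA : ℕ → Fin PA.length × Bool} {sF : ℕ → Fin PF.length × Bool} (hn : 0 < n)
    (hcyc : sA n = sA 0)
    (surjA : ∀ k, ∃ t < n, (sA t).1 = k) (surjF : ∀ k, ∃ t < n, (sF t).1 = k)
    (injA : ∀ a b, a < n → b < n → (sA a).1 = (sA b).1 → a = b)
    (injF : ∀ a b, a < n → b < n → (sF a).1 = (sF b).1 → a = b)
    (jAF : ∀ t, la (Prod.map id not (sA t)) = lf (sF t))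
    (jFA : ∀ t, lf (Prod.map id not (sF t)) = la (sA (t + 1))) :
    IsHamCycleListing G.Adj (List.ofFn fun t : Fin n =>
      (bif (sA t).2 then (PA[(sA t).1]).1.verts.reverse else (PA[(sA t).1]).1.verts) ++
        (bif (sF t).2 then (PF[(sF t).1]).verts.reverse else (PF[(sF t).1]).verts)).flatten := by
  -- notation
  set qA : ℕ → VSeq V := fun t => (PA[(sA t).1]).1 with hqA
  set pF : ℕ → VSeq V := fun t => PF[(sF t).1] with hpF
  set blk : Fin n → List V := fun t =>
    (bif (sA t).2 then (qA t).verts.reverse else (qA t).verts) ++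
      (bif (sF t).2 then (pF t).verts.reverse else (pF t).verts) with hblk
  change IsHamCycleListing G.Adj (List.ofFn blk).flatten
  have hqA_mem : ∀ t, qA t ∈ PA.map Prod.fst := fun t =>
    List.mem_map.2 ⟨PA[(sA t).1], List.getElem_mem _, rfl⟩
  have hpF_mem : ∀ t, pF t ∈ PF := fun t => List.getElem_mem _
  have hAverts : ∀ t v, v ∈ (qA t).verts → v ∈ Fᶜ := fun t v hv =>
    hcA.mem_of_mem_verts (hqA_mem t) hv
  have hFverts : ∀ t v, v ∈ (pF t).verts → v ∈ F := fun t v hv =>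
    hcF.mem_of_mem_verts (hpF_mem t) hv
  have hAF : ∀ a b v, v ∈ (qA a).verts → v ∈ (pF b).verts → False := fun a b v hvA hvF =>
    (Finset.mem_compl.1 (hAverts a v hvA)) (hFverts b v hvF)
  -- labels of the other ends
  have hla' : ∀ h, la (Prod.map id not h) = bif h.2 then (PA[h.1]).2.1 else (PA[h.1]).2.2 :=
    fun ⟨k, b⟩ => by rw [hla]; cases b <;> rfl
  have hlf' : ∀ f, lf (Prod.map id not f) =
      nbA G F (bif f.2 then (PF[f.1]).first else (PF[f.1]).last) :=
    fun ⟨k, b⟩ => by rw [hlf]; cases b <;> rfl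
  have hmem' : ∀ q : VSeq V × (Finset V × Finset V), q.1.first ∈ q.2.1 ∧ q.1.last ∈ q.2.2 →
      ∀ b, (bif b then q.1.first else q.1.last) ∈ (bif b then q.2.1 else q.2.2) :=
    fun q h b => by cases b; exacts [h.2, h.1]
  -- junction adjacencies
  have hjAF : ∀ t, G.Adj (bif (sA t).2 then (qA t).first else (qA t).last)
      (bif (sF t).2 then (pF t).last else (pF t).first) := by
    intro t
    have h1 : (bif (sA t).2 then (qA t).first else (qA t).last) ∈ la (Prod.map id not (sA t)) := by
      rw [hla']
      exact hmem' _ (hlab _ (List.getElem_mem _)) _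
    rw [jAF t, hlf] at h1
    exact (adj_of_mem_nbA G F h1).symm
  have hjFA : ∀ t, G.Adj (bif (sF t).2 then (pF t).first else (pF t).last)
      (bif (sA (t + 1)).2 then (qA (t + 1)).last else (qA (t + 1)).first) := by
    intro t
    have h1 : (bif (sA (t + 1)).2 then (qA (t + 1)).last else (qA (t + 1)).first) ∈
        la (sA (t + 1)) := by
      rw [hla]
      exact endAt_mem_labAt (hlab _ (List.getElem_mem _)) _
    rw [← jFA t, hlf'] at h1
    exact adj_of_mem_nbA G F h1
  have hblk_ne : ∀ t, blk t ≠ [] := fun t => by simp [hblk, VSeq.trav_ne_nil]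
  have hblk_head : ∀ t, (blk t).head (hblk_ne t) =
      bif (sA t).2 then (qA t).last else (qA t).first := fun t => by
    rw [List.head_eq_iff_head?_eq_some, hblk, List.head?_append,
      List.head?_eq_some_head (VSeq.trav_ne_nil _ _), Option.some_or, VSeq.head_trav]
  have hblk_last : ∀ t, (blk t).getLast (hblk_ne t) =
      bif (sF t).2 then (pF t).first else (pF t).last := fun t => by
    rw [List.getLast_eq_iff_getLast?_eq_some, hblk, List.getLast?_append,
      List.getLast?_eq_some_getLast (VSeq.trav_ne_nil _ _), Option.some_or, VSeq.getLast_trav]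
  rw [isHamCycleListing_iff_isChain]
  refine ⟨?_, ?_, ?_, ?_⟩
  · -- no duplicates
    rw [List.nodup_flatten]
    constructor
    · rw [List.forall_mem_ofFn_iff]
      intro t
      rw [List.nodup_append]
      refine ⟨VSeq.nodup_trav (hcA.nodup_verts (hqA_mem t)) _,
        VSeq.nodup_trav (hcF.nodup_verts (hpF_mem t)) _, ?_⟩
      intro a ha b hb hab
      rw [VSeq.mem_trav] at ha hb
      subst hab
      exact hAF t t a ha hb
    · rw [List.pairwise_ofFn]
      intro i j hij
      have hij' : (i : ℕ) ≠ j := Nat.ne_of_lt hij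
      simp only [hblk, List.disjoint_append_left, List.disjoint_append_right]
      refine ⟨⟨fun v hv hv' => ?_, fun v hv hv' => ?_⟩, fun v hv hv' => ?_, fun v hv hv' => ?_⟩ <;>
        rw [VSeq.mem_trav] at hv hv'
      · have hne : ((sA i).1 : ℕ) ≠ (sA j).1 := fun e =>
          hij' (injA i j i.2 j.2 (Fin.ext e))
        have hd := hcA.disjoint (i := (sA i).1) (j := (sA j).1) (by simp) (by simp) hne
        simp only [List.getElem_map, Fin.getElem_fin, hqA] at hd hv hv'
        exact hd hv hv'
      · exact hAF _ _ v hv' hv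
      · exact hAF _ _ v hv hv'
      · have hne : ((sF i).1 : ℕ) ≠ (sF j).1 := fun e =>
          hij' (injF i j i.2 j.2 (Fin.ext e))
        have hd := hcF.disjoint (i := (sF i).1) (j := (sF j).1) (by simp) (by simp) hne
        simp only [Fin.getElem_fin, hpF] at hd hv hv'
        exact hd hv hv'
  · -- every vertex is listed
    intro v
    rw [List.mem_flatten]
    by_cases hvF : v ∈ F
    · obtain ⟨p, hp, hv⟩ := hcF.mem_iff.1 hvF
      obtain ⟨k, hk, rfl⟩ := List.getElem_of_mem hp
      obtain ⟨t, ht, hkt⟩ := surjF ⟨k, hk⟩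
      refine ⟨blk ⟨t, ht⟩, List.mem_ofFn.2 ⟨⟨t, ht⟩, rfl⟩, List.mem_append_right _ ?_⟩
      rw [VSeq.mem_trav]
      simp only [hpF, Fin.getElem_fin, hkt]
      exact hv
    · have hvA : v ∈ Fᶜ := Finset.mem_compl.2 hvF
      obtain ⟨q, hq, hv⟩ := hcA.mem_iff.1 hvA
      obtain ⟨k, hk, rfl⟩ := List.getElem_of_mem hq
      rw [List.length_map] at hk
      obtain ⟨t, ht, hkt⟩ := surjA ⟨k, hk⟩
      refine ⟨blk ⟨t, ht⟩, List.mem_ofFn.2 ⟨⟨t, ht⟩, rfl⟩, List.mem_append_left _ ?_⟩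
      rw [VSeq.mem_trav]
      simp only [hqA, Fin.getElem_fin, hkt]
      simpa [List.getElem_map] using hv
  · -- consecutive vertices are adjacent
    rw [List.isChain_flatten (by simpa [List.mem_ofFn] using fun t => hblk_ne t)]
    constructor
    · rw [List.forall_mem_ofFn_iff]
      intro t
      simp only [hblk]
      rw [List.isChain_append]
      exact ⟨VSeq.isChain_trav (hcA.isChain (hqA_mem t)) _,
        VSeq.isChain_trav (hcF.isChain (hpF_mem t)) _,
        forall_getLast?_head? (VSeq.trav_ne_nil _ _) (VSeq.trav_ne_nil _ _)
          (by rw [VSeq.getLast_trav, VSeq.head_trav]; exact hjAF t)⟩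
    · rw [List.isChain_ofFn]
      intro i hi
      exact forall_getLast?_head? (hblk_ne _) (hblk_ne _)
        (by rw [hblk_last, hblk_head]; exact hjFA i)
  · -- the wrap-around pair
    intro hl
    obtain ⟨m, rfl⟩ : ∃ m, n = m + 1 := ⟨n - 1, by omega⟩
    have hhead : (List.ofFn blk).flatten.head hl =
        bif (sA 0).2 then (qA 0).last else (qA 0).first := by
      rw [List.head_eq_iff_head?_eq_some, List.ofFn_succ, List.flatten_cons, List.head?_append,
        List.head?_eq_some_head (hblk_ne 0), Option.some_or, hblk_head]
      rfl
    have hlast : (List.ofFn blk).flatten.getLast hl =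
        bif (sF m).2 then (pF m).first else (pF m).last := by
      rw [List.getLast_eq_iff_getLast?_eq_some, List.ofFn_succ', List.concat_eq_append,
        List.flatten_append, List.flatten_singleton, List.getLast?_append,
        List.getLast?_eq_some_getLast (hblk_ne _), Option.some_or, hblk_last, Fin.val_last]
    rw [hhead, hlast]
    have := hjFA m
    simp only [hqA, hcyc] at this ⊢
    exact this

variable (G F) in
/-- **Backward direction of `stub_kotzig`**: the Kotzig interface data re-assemble into a
Hamiltonian cycle (Kotzig's alternating closed trail, then junction edges from equal keys). -/
theorem isHamiltonian_of_kotzigPred (h3 : 3 ≤ Fintype.card V) (hA : Fᶜ.Nonempty)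
    (hK : KotzigPred G F) : G.IsHamiltonian := by
  obtain ⟨PF, PA, hcF, hcA, hlab, hbal, hconn⟩ := hK
  obtain ⟨a₀, ha₀⟩ := hA
  have hPA : 0 < PA.length := by
    obtain ⟨q, hq, -⟩ := hcA.mem_iff.1 ha₀
    have : PA.map Prod.fst ≠ [] := List.ne_nil_of_mem hq
    rw [List.length_pos_iff]
    rintro rfl
    exact this rfl
  have hla : ∀ h : Fin PA.length × Bool, (fun h : Fin PA.length × Bool =>
      bif h.2 then (PA[h.1]).2.2 else (PA[h.1]).2.1) h =
        bif h.2 then (PA[h.1]).2.2 else (PA[h.1]).2.1 := fun h => rfl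
  have hlf : ∀ f : Fin PF.length × Bool, (fun f : Fin PF.length × Bool =>
      nbA G F (bif f.2 then (PF[f.1]).last else (PF[f.1]).first)) f =
        nbA G F (bif f.2 then (PF[f.1]).last else (PF[f.1]).first) := fun f => rfl
  obtain ⟨n, sA, sF, hn, h0, hnn, surjA, surjF, injA, injF, jAF, jFA⟩ :=
    alternating_trail _ _ (⟨0, hPA⟩, false) (balanced_of_slots hla hlf hbal)
      (closure_of_reachable hla hlf hbal hconn _)
  exact (isHamiltonian_iff_of_three_le_card G h3).2
    ⟨_, isHamCycleListing_assemble hcF hcA hlab hla hlf hn (hnn.trans h0.symm) surjA surjF injA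
      injF jAF jFA⟩

end Backward

/-- Registered sub-goal of `stub_kotzig` served by this file (`--supports stmt-PneNP-10637`): the
backward direction of `stub_kotzig`, `isHamiltonian_of_kotzigPred`. -/
theorem stub_kotzig_backward {V : Type*} [Fintype V] [DecidableEq V] (G : SimpleGraph V)
    [DecidableRel G.Adj] (F : Finset V) (h3 : 3 ≤ Fintype.card V) (hA : Fᶜ.Nonempty)
    (hK : KotzigPred G F) : G.IsHamiltonian :=
  isHamiltonian_of_kotzigPred G F h3 hA hK

end Summit.PneNP.PneNP.Theorems.HamCompilesKC
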